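import Literature.Barriers.RiemannHypothesis.DavenportHeilbronnHamburgerTools
import Literature.Analysis.SpecialFunctions.GammaVerticalBounds
import Mathlib.MeasureTheory.Integral.Prod
import Mathlib.Analysis.SpecialFunctions.ImproperIntegrals
import HarnessLib

/-!
# Tools for Hamburger's theorem, IV: Mellin–Barnes integrals for `1/(t² + n²)` and `e^{−ny}`

Support file for the discharge of `Literature.Barriers.RiemannHypothesis.Hamburger`
(Titchmarsh, *The Theory of the Riemann Zeta-Function*, §2.13). Everything here is PROVED.

Titchmarsh (after Siegel) passes from the functional equation to the partial-fraction series
`∑ aₙ/(t² + n²)` in two steps (theta relation, then `∫₀^∞ · e^{−πt²x} dx`). The two kernels compose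
to the Mellin pair `1/(1 + X) ↔ Γ(w)Γ(1 − w)` (`0 < re w < 1`), and this file provides that pair
directly, so that the partial-fraction series of an absolutely convergent Dirichlet series is ONE
vertical integral (`tsum_div_sq_add_sq_eq_integral`):

  `∑_{n ≥ 1} aₙ/(t² + n²) = (1/2π) ∫ L(a, 2w) Γ(w)Γ(1 − w) t^{2w−2} dy`,  `w = c + iy`, `1/2 < c < 1`.

Also here: the Cahen–Mellin representation `∑ bₙ e^{−ny} = (1/2π)∫ L(b, w) y^{−w} Γ(w) dy` at an
ARBITRARY abscissa `c > 0` of absolute convergence (the tree's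
`Literature.Analysis.Complex.tsum_mul_exp_neg_eq_integral_LSeries` has `c ≤ 2`).

## References

* [Titchmarsh1986] E. C. Titchmarsh, *The Theory of the Riemann Zeta-Function*, 2nd ed. revised by
  D. R. Heath-Brown, Oxford 1986, §2.13.
-/

noncomputable section

open _root_.Complex Set MeasureTheory Filter Real
open scoped _root_.Topology

namespace Literature.Barriers.RiemannHypothesis

namespace Hamburger1921

open Literature.Analysis.Complex Literature.Analysis.SpecialFunctions

/-! ### `Γ` along lines in the right half-plane -/

/-- `y ↦ Γ(g(y))` is continuous when `g` is continuous with values in `re s > 0`. [folklore] -/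
theorem continuous_Gamma_comp {g : ℝ → ℂ} (hg : Continuous g) (hre : ∀ y, 0 < (g y).re) :
    Continuous fun y ↦ Complex.Gamma (g y) := by
  refine continuous_iff_continuousAt.2 fun y ↦ ?_
  have hΓ : DifferentiableAt ℂ Complex.Gamma (g y) := by
    refine Complex.differentiableAt_Gamma _ fun m h ↦ ?_
    have h1 := congrArg Complex.re h
    have h2 := hre y
    rw [h1, neg_re, natCast_re] at h2
    linarith [(Nat.cast_nonneg m : (0 : ℝ) ≤ m)]
  exact hΓ.continuousAt.comp hg.continuousAt

/-- `y ↦ Γ(c + iy) Γ(1 − c − iy)` is integrable on `ℝ` for `0 < c < 1`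
(`Γ(c + iy)` is integrable and `|Γ(1 − c − iy)| ≤ Γ(1 − c)`). [folklore] -/
theorem integrable_Gamma_mul_Gamma_one_sub {c : ℝ} (hc0 : 0 < c) (hc1 : c < 1) :
    Integrable fun y : ℝ ↦ Complex.Gamma (c + y * I) * Complex.Gamma (1 - (c + y * I)) := by
  have hΓ := integrable_Gamma_vertical_of_pos hc0
  have hcont : Continuous fun y : ℝ ↦ Complex.Gamma (1 - (c + y * I)) :=
    continuous_Gamma_comp (by fun_prop) fun y ↦ by simp; linarith
  have h := hΓ.mul_bdd hcont.aestronglyMeasurable (c := Real.Gamma (1 - c))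
    (Eventually.of_forall fun y ↦ ?_)
  · exact h
  · have h1 := GammaVert.norm_Gamma_le_Gamma_re (x := 1 - c) (by linarith) (-y)
    have e : ((1 - c : ℝ) : ℂ) + ((-y : ℝ) : ℂ) * I = 1 - ((c : ℂ) + y * I) := by push_cast; ring
    rwa [e] at h1

/-! ### The Mellin pair `1/(1 + X) ↔ Γ(w)Γ(1 − w)` -/

/-- **Mellin–Barnes integral for `1/(1 + X)`.** For `0 < c < 1` and `X > 0`,
`(1/2π) ∫ Γ(c+iy) Γ(1−c−iy) X^{−(c+iy)} dy = 1/(1 + X)`, i.e.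
`1/(1 + X) = (1/2πi) ∫_{(c)} Γ(w)Γ(1−w) X^{−w} dw` (the Mellin pair `1/(1+x) ↔ π/sin(πw)`). Proof:
integrate the Cahen–Mellin integral `e^{−Xx} = (1/2πi)∫_{(c)} Γ(w)(Xx)^{−w} dw` against `e^{−x} dx`
over `(0, ∞)` and use `∫₀^∞ x^{−w} e^{−x} dx = Γ(1 − w)` (Fubini). [folklore] -/
theorem mellinInv_Gamma_mul_Gamma_one_sub {c : ℝ} (hc0 : 0 < c) (hc1 : c < 1) {X : ℝ}
    (hX : 0 < X) :
    (1 / (2 * π) : ℂ) * ∫ y : ℝ, Complex.Gamma (c + y * I) * Complex.Gamma (1 - (c + y * I)) *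
        (X : ℂ) ^ (-(c + y * I)) = 1 / (1 + X) := by
  have hπ : (π : ℂ) ≠ 0 := ofReal_ne_zero.2 Real.pi_ne_zero
  -- the two-variable integrand
  set f : ℝ → ℝ → ℂ := fun x y ↦ (Real.exp (-x) : ℂ) * ((((X * x : ℝ)) : ℂ) ^ (-(c + y * I)) *
    Complex.Gamma (c + y * I)) with hf
  -- Step 1: the `x`-integral for fixed `y`
  have hinner : ∀ y : ℝ, ∫ x in Ioi (0 : ℝ), f x y =
      Complex.Gamma (c + y * I) * Complex.Gamma (1 - (c + y * I)) * (X : ℂ) ^ (-(c + y * I)) := by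
    intro y
    have hre : 0 < (1 - ((c : ℂ) + y * I)).re := by simp; linarith
    have hΓ1 : Complex.Gamma (1 - (c + y * I)) =
        ∫ x in Ioi (0 : ℝ), (Real.exp (-x) : ℂ) * (x : ℂ) ^ (-(c + y * I)) := by
      rw [Complex.Gamma_eq_integral hre, Complex.GammaIntegral]
      refine setIntegral_congr_fun measurableSet_Ioi fun x _ ↦ ?_
      congr 2
      ring
    calc ∫ x in Ioi (0 : ℝ), f x y
        = ∫ x in Ioi (0 : ℝ), (Complex.Gamma (c + y * I) * (X : ℂ) ^ (-(c + y * I))) *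
            ((Real.exp (-x) : ℂ) * (x : ℂ) ^ (-(c + y * I))) := by
          refine setIntegral_congr_fun measurableSet_Ioi fun x hx ↦ ?_
          simp only [hf]
          rw [Complex.ofReal_mul, Complex.mul_cpow_ofReal_nonneg hX.le (le_of_lt hx)]
          ring
      _ = (Complex.Gamma (c + y * I) * (X : ℂ) ^ (-(c + y * I))) *
            ∫ x in Ioi (0 : ℝ), (Real.exp (-x) : ℂ) * (x : ℂ) ^ (-(c + y * I)) :=
          integral_const_mul _ _
      _ = _ := by rw [← hΓ1]; ring
  -- Step 2: the `y`-integral for fixed `x > 0` (Cahen–Mellin)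
  have houter : ∀ x : ℝ, 0 < x → ∫ y : ℝ, f x y =
      (Real.exp (-x) : ℂ) * ((2 * π : ℂ) * (Real.exp (-(X * x)) : ℂ)) := by
    intro x hx
    simp only [hf]
    rw [integral_const_mul]
    congr 1
    rw [← exp_neg_eq_mellinInv_Gamma_of_pos hc0 (mul_pos hX hx), ← mul_assoc,
      show (2 * π : ℂ) * (1 / (2 * π)) = 1 by field_simp, one_mul]
  -- Step 3: integrability on `(0, ∞) × ℝ`
  have hΓ := integrable_Gamma_vertical_of_pos hc0
  have hint : Integrable (Function.uncurry f) ((volume.restrict (Ioi (0 : ℝ))).prod volume) := by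
    have hμ : ((volume : Measure ℝ).restrict (Ioi 0)).prod (volume : Measure ℝ) =
        ((volume : Measure ℝ).prod (volume : Measure ℝ)).restrict (Ioi 0 ×ˢ univ) :=
      Measure.restrict_prod_eq_prod_univ _
    have hmeas : AEStronglyMeasurable (Function.uncurry f)
        (((volume : Measure ℝ).restrict (Ioi 0)).prod volume) := by
      rw [hμ]
      refine ContinuousOn.aestronglyMeasurable ?_ (measurableSet_Ioi.prod MeasurableSet.univ)
      have h1 : ContinuousOn (fun p : ℝ × ℝ ↦ (((X * p.1 : ℝ)) : ℂ) ^ (-(c + p.2 * I)))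
          (Ioi (0 : ℝ) ×ˢ univ) := by
        refine ContinuousOn.cpow (by fun_prop) (by fun_prop) fun p hp ↦ ?_
        rw [mem_prod, mem_Ioi] at hp
        exact Or.inl (by simpa using mul_pos hX hp.1)
      have h2 : Continuous fun p : ℝ × ℝ ↦ Complex.Gamma (c + p.2 * I) :=
        (continuous_Gamma_comp (g := fun y : ℝ ↦ (c : ℂ) + y * I) (by fun_prop)
          (fun y ↦ by simpa using hc0)).comp continuous_snd
      have h3 : Continuous fun p : ℝ × ℝ ↦ (Real.exp (-p.1) : ℂ) := by fun_prop
      show ContinuousOn (fun p : ℝ × ℝ ↦ (Real.exp (-p.1) : ℂ) * ((((X * p.1 : ℝ)) : ℂ) ^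
        (-(c + p.2 * I)) * Complex.Gamma (c + p.2 * I))) _
      exact h3.continuousOn.mul (h1.mul h2.continuousOn)
    -- the product majorant `e^{-x}(Xx)^{-c} · ‖Γ(c+iy)‖`
    have hg1 : Integrable (fun x : ℝ ↦ Real.exp (-x) * (X * x) ^ (-c))
        ((volume : Measure ℝ).restrict (Ioi 0)) := by
      have h : IntegrableOn (fun x : ℝ ↦ X ^ (-c) * (Real.exp (-x) * x ^ ((1 - c) - 1))) (Ioi 0) :=
        (Real.GammaIntegral_convergent (s := 1 - c) (by linarith)).const_mul (X ^ (-c))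
      refine h.congr_fun (fun x hx ↦ ?_) measurableSet_Ioi
      rw [mem_Ioi] at hx
      rw [Real.mul_rpow hX.le hx.le, show (1 - c) - 1 = -c by ring]
      ring
    refine Integrable.mono' (hg1.mul_prod hΓ.norm) hmeas ?_
    rw [hμ, ae_restrict_iff' (measurableSet_Ioi.prod MeasurableSet.univ)]
    refine Eventually.of_forall fun p hp ↦ ?_
    obtain ⟨x, y⟩ := p
    rw [mem_prod, mem_Ioi] at hp
    have hx : 0 < x := hp.1
    have hre : (-((c : ℂ) + y * I)).re = -c := by simp
    simp only [Function.uncurry_apply_pair, hf]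
    rw [norm_mul, norm_mul, Complex.norm_real, Real.norm_of_nonneg (Real.exp_pos _).le,
      Complex.norm_cpow_eq_rpow_re_of_pos (mul_pos hX hx), hre]
    exact le_of_eq (by ring)
  -- Step 4: Fubini and the elementary integral `∫₀^∞ e^{-(1+X)x} dx = 1/(1+X)`
  have hswap := integral_integral_swap hint
  have h1X : (-(1 + (X : ℂ))).re < 0 := by simp; linarith
  calc (1 / (2 * π) : ℂ) * ∫ y : ℝ, Complex.Gamma (c + y * I) * Complex.Gamma (1 - (c + y * I)) *
          (X : ℂ) ^ (-(c + y * I))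
      = (1 / (2 * π) : ℂ) * ∫ y : ℝ, ∫ x in Ioi (0 : ℝ), f x y := by
        congr 1
        exact integral_congr_ae (Eventually.of_forall fun y ↦ (hinner y).symm)
    _ = (1 / (2 * π) : ℂ) * ∫ x in Ioi (0 : ℝ), ∫ y : ℝ, f x y := by rw [hswap]
    _ = (1 / (2 * π) : ℂ) * ∫ x in Ioi (0 : ℝ),
          (Real.exp (-x) : ℂ) * ((2 * π : ℂ) * (Real.exp (-(X * x)) : ℂ)) := by
        congr 1
        exact setIntegral_congr_fun measurableSet_Ioi fun x hx ↦ houter x hx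
    _ = ∫ x in Ioi (0 : ℝ), Complex.exp (-(1 + (X : ℂ)) * x) := by
        rw [← integral_const_mul]
        refine setIntegral_congr_fun measurableSet_Ioi fun x _ ↦ ?_
        rw [Complex.ofReal_exp, Complex.ofReal_exp, show -(1 + (X : ℂ)) * x = -x + -(X * x) by
          ring, Complex.exp_add]
        push_cast
        field_simp
    _ = 1 / (1 + X) := by
        rw [integral_exp_mul_complex_Ioi h1X 0]
        simp only [ofReal_zero, mul_zero, Complex.exp_zero]
        have : (1 + (X : ℂ)) ≠ 0 := fun h ↦ by
          have := congrArg Complex.re h; simp at this; linarith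
        field_simp

/-! ### The partial-fraction series of a Dirichlet series as a vertical integral -/

/-- A positive real base: `p^w = e^{w log p}`. [folklore] -/
theorem ofReal_cpow_eq_exp {p : ℝ} (hp : 0 < p) (w : ℂ) :
    (p : ℂ) ^ w = Complex.exp (w * Real.log p) := by
  rw [Complex.cpow_def_of_ne_zero (ofReal_ne_zero.2 hp.ne'), ← Complex.ofReal_log hp.le, mul_comm]

/-- Bookkeeping of powers: `(n²/t²)^{−w} / t² = t^{2w−2} / n^{2w}` (`n, t > 0`). [folklore] -/
theorem div_sq_cpow_neg_div_sq {n t : ℝ} (hn : 0 < n) (ht : 0 < t) (w : ℂ) :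
    (((n ^ 2 / t ^ 2 : ℝ)) : ℂ) ^ (-w) / (t : ℂ) ^ 2 = (t : ℂ) ^ (2 * w - 2) / (n : ℂ) ^ (2 * w) := by
  have hlog : Real.log (n ^ 2 / t ^ 2) = 2 * Real.log n - 2 * Real.log t := by
    rw [Real.log_div (by positivity) (by positivity), Real.log_pow, Real.log_pow]; push_cast; ring
  have ht2 : (t : ℂ) ^ 2 = Complex.exp (2 * Real.log t) := by
    rw [show (2 : ℂ) * Real.log t = Real.log t + Real.log t by ring, Complex.exp_add,
      Complex.ofReal_log ht.le, Complex.exp_log (ofReal_ne_zero.2 ht.ne'), sq]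
  rw [ofReal_cpow_eq_exp (by positivity) (-w), ofReal_cpow_eq_exp ht, ofReal_cpow_eq_exp hn, hlog,
    ht2, div_eq_div_iff (Complex.exp_ne_zero _) (Complex.exp_ne_zero _), ← Complex.exp_add,
    ← Complex.exp_add]
  congr 1
  push_cast
  ring

/-- The terms: for `n ≥ 1`, `t > 0`, `0 < c < 1`, `w = c + iy`,
`aₙ/(t² + n²) = (1/2π) ∫ aₙ n^{−2w} · Γ(w)Γ(1−w) t^{2w−2} dy`
(the Mellin–Barnes integral for `1/(1+X)` at `X = n²/t²`). [folklore] -/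
theorem div_sq_add_sq_eq_integral_term (a : ℕ → ℂ) {c : ℝ} (hc0 : 0 < c) (hc1 : c < 1) {t : ℝ}
    (ht : 0 < t) (n : ℕ) :
    (if n = 0 then 0 else a n / ((t : ℂ) ^ 2 + (n : ℂ) ^ 2)) =
      (1 / (2 * π) : ℂ) * ∫ y : ℝ, LSeries.term a (2 * (c + y * I)) n *
        (Complex.Gamma (c + y * I) * Complex.Gamma (1 - (c + y * I)) *
          (t : ℂ) ^ (2 * (c + y * I) - 2)) := by
  rcases eq_or_ne n 0 with rfl | hn
  · simp
  simp only [hn, if_false]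
  have hn0 : (0 : ℝ) < n := by exact_mod_cast Nat.pos_of_ne_zero hn
  have htC : (t : ℂ) ≠ 0 := ofReal_ne_zero.2 ht.ne'
  have hnC : (n : ℂ) ≠ 0 := by exact_mod_cast hn
  -- `1/(1 + n²/t²) = t²/(t² + n²)`
  have hX : 0 < (n : ℝ) ^ 2 / t ^ 2 := by positivity
  have h := mellinInv_Gamma_mul_Gamma_one_sub hc0 hc1 hX
  have hden : (t : ℂ) ^ 2 + (n : ℂ) ^ 2 ≠ 0 := by
    intro h0
    have := congrArg Complex.re h0
    simp [sq] at this
    nlinarith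
  have e1 : a n / ((t : ℂ) ^ 2 + (n : ℂ) ^ 2) = a n / (t : ℂ) ^ 2 * (1 / (1 + (((n : ℝ) ^ 2 / t ^ 2 : ℝ) : ℂ))) := by
    push_cast
    field_simp
  rw [e1, ← h, ← mul_assoc, mul_comm (a n / (t : ℂ) ^ 2), mul_assoc, ← integral_const_mul]
  congr 1
  refine integral_congr_ae (Eventually.of_forall fun y ↦ ?_)
  simp only
  rw [LSeries.term_of_ne_zero hn]
  have key := div_sq_cpow_neg_div_sq hn0 ht (c + y * I)
  rw [Complex.ofReal_natCast] at key
  calc a n / (t : ℂ) ^ 2 * (Complex.Gamma (c + y * I) * Complex.Gamma (1 - (c + y * I)) *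
          ((((n : ℝ) ^ 2 / t ^ 2 : ℝ)) : ℂ) ^ (-(c + y * I)))
      = a n * (Complex.Gamma (c + y * I) * Complex.Gamma (1 - (c + y * I))) *
          (((((n : ℝ) ^ 2 / t ^ 2 : ℝ)) : ℂ) ^ (-(c + y * I)) / (t : ℂ) ^ 2) := by ring
    _ = a n * (Complex.Gamma (c + y * I) * Complex.Gamma (1 - (c + y * I))) *
          ((t : ℂ) ^ (2 * (c + y * I) - 2) / (n : ℂ) ^ (2 * (c + y * I))) := by rw [key]
    _ = _ := by ring

/-- **Mellin–Barnes representation of the partial-fraction series of a Dirichlet series.** If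
`∑ aₙ n^{−s}` is absolutely summable at `s = 2c` with `1/2 < c < 1`... more precisely for any
`0 < c < 1` at which `∑ |aₙ| n^{−2c} < ∞`, and `t > 0`, then with `w = c + iy`
`∑_{n ≥ 1} aₙ/(t² + n²) = (1/2π) ∫ L(a, 2w) Γ(w)Γ(1−w) t^{2w−2} dy`
(termwise `div_sq_add_sq_eq_integral_term`; `∑ ∫ = ∫ ∑` by absolute convergence). [folklore] -/
theorem tsum_div_sq_add_sq_eq_integral (a : ℕ → ℂ) {c : ℝ} (hc0 : 0 < c) (hc1 : c < 1)
    (hsum : LSeriesSummable a (2 * c)) {t : ℝ} (ht : 0 < t) :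
    ∑' n : ℕ, (if n = 0 then 0 else a n / ((t : ℂ) ^ 2 + (n : ℂ) ^ 2)) =
      (1 / (2 * π) : ℂ) * ∫ y : ℝ, LSeries a (2 * (c + y * I)) *
        (Complex.Gamma (c + y * I) * Complex.Gamma (1 - (c + y * I)) *
          (t : ℂ) ^ (2 * (c + y * I) - 2)) := by
  have hΓΓ := integrable_Gamma_mul_Gamma_one_sub hc0 hc1
  set K : ℝ → ℂ := fun y ↦ Complex.Gamma (c + y * I) * Complex.Gamma (1 - (c + y * I)) *
    (t : ℂ) ^ (2 * (c + y * I) - 2) with hK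
  set G : ℕ → ℝ → ℂ := fun n y ↦ LSeries.term a (2 * (c + y * I)) n * K y with hG
  have hre : ∀ y : ℝ, (2 * ((c : ℂ) + y * I) - 2).re = 2 * c - 2 := by intro y; simp
  have hnormterm : ∀ (n : ℕ) (y : ℝ),
      ‖LSeries.term a (2 * ((c : ℂ) + y * I)) n‖ = ‖LSeries.term a (2 * c) n‖ := by
    intro n y
    simp [LSeries.norm_term_eq]
  have hnormK : ∀ y, ‖K y‖ =
      ‖Complex.Gamma (c + y * I) * Complex.Gamma (1 - (c + y * I))‖ * t ^ (2 * c - 2) := by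
    intro y
    simp only [hK, norm_mul]
    rw [Complex.norm_cpow_eq_rpow_re_of_pos ht, hre]
  have hcontt : Continuous fun y : ℝ ↦ (t : ℂ) ^ (2 * (c + y * I) - 2) :=
    Continuous.const_cpow (by fun_prop) (Or.inl (by exact_mod_cast ht.ne'))
  have hcontn : ∀ n : ℕ, Continuous fun y : ℝ ↦ LSeries.term a (2 * (c + y * I)) n := by
    intro n
    rcases eq_or_ne n 0 with rfl | hn
    · simp only [LSeries.term_zero]; exact continuous_const
    · simp only [LSeries.term_of_ne_zero hn, div_eq_mul_inv]
      refine continuous_const.mul (Continuous.inv₀ ?_ fun y ↦ ?_)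
      · exact Continuous.const_cpow (by fun_prop) (Or.inl (by exact_mod_cast hn))
      · exact (Complex.cpow_ne_zero_iff_of_exponent_ne_zero (by
          intro h0; have := congrArg Complex.re h0; simp at this; linarith)).2
          (by exact_mod_cast hn)
  have hint : ∀ n, Integrable (G n) := by
    intro n
    have h := hΓΓ.bdd_mul (((hcontn n).mul hcontt).aestronglyMeasurable)
      (c := ‖LSeries.term a (2 * c) n‖ * t ^ (2 * c - 2)) (Eventually.of_forall fun y ↦ ?_)
    · refine h.congr (Eventually.of_forall fun y ↦ ?_)
      simp only [hG, hK, Pi.mul_apply]; ring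
    · simp only [Pi.mul_apply]
      rw [norm_mul, Complex.norm_cpow_eq_rpow_re_of_pos ht, hnormterm, hre]
  have hnormint : ∀ n, ∫ y, ‖G n y‖ = ‖LSeries.term a (2 * c) n‖ * (t ^ (2 * c - 2) *
      ∫ y : ℝ, ‖Complex.Gamma (c + y * I) * Complex.Gamma (1 - (c + y * I))‖) := by
    intro n
    have : ∀ y, ‖G n y‖ = ‖LSeries.term a (2 * c) n‖ * (t ^ (2 * c - 2) *
        ‖Complex.Gamma (c + y * I) * Complex.Gamma (1 - (c + y * I))‖) := by
      intro y
      rw [hG, norm_mul, hnormK, hnormterm]; ring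
    simp_rw [this]
    rw [MeasureTheory.integral_const_mul, MeasureTheory.integral_const_mul]
  have hsumm : Summable fun n ↦ ∫ y, ‖G n y‖ := by
    simp_rw [hnormint]
    exact (summable_norm_iff.2 hsum).mul_right _
  calc ∑' n : ℕ, (if n = 0 then 0 else a n / ((t : ℂ) ^ 2 + (n : ℂ) ^ 2))
      = ∑' n : ℕ, (1 / (2 * π) : ℂ) * ∫ y : ℝ, G n y :=
        tsum_congr fun n ↦ div_sq_add_sq_eq_integral_term a hc0 hc1 ht n
    _ = (1 / (2 * π) : ℂ) * ∑' n : ℕ, ∫ y : ℝ, G n y := tsum_mul_left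
    _ = (1 / (2 * π) : ℂ) * ∫ y : ℝ, ∑' n : ℕ, G n y := by
        rw [integral_tsum_of_summable_integral_norm hint hsumm]
    _ = _ := by
        congr 1
        refine integral_congr_ae (Eventually.of_forall fun y ↦ ?_)
        simp only [hG]
        rw [tsum_mul_right, LSeries]

/-! ### `∑ bₙ e^{−ny}` as a vertical integral, at any abscissa of absolute convergence -/

/-- The terms: for `n ≥ 1`, `w > 0`, `c > 0`,
`b(n) e^{−nw} = (1/2π) ∫ b(n) n^{−(c+iy)} · w^{−(c+iy)} Γ(c+iy) dy`. [folklore] -/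
theorem mul_exp_neg_eq_integral_term_of_pos (b : ℕ → ℂ) {c : ℝ} (hc : 0 < c) {w : ℝ}
    (hw : 0 < w) (n : ℕ) :
    (if n = 0 then 0 else b n * (Real.exp (-(n * w)) : ℂ)) =
      (1 / (2 * π) : ℂ) * ∫ y : ℝ, LSeries.term b (c + y * I) n *
        ((w : ℂ) ^ (-(c + y * I)) * Complex.Gamma (c + y * I)) := by
  rcases eq_or_ne n 0 with rfl | hn
  · simp
  simp only [hn, if_false]
  have hn0 : (0 : ℝ) < n := by exact_mod_cast Nat.pos_of_ne_zero hn
  have h := exp_neg_eq_mellinInv_Gamma_of_pos hc (mul_pos hn0 hw)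
  simp_rw [Complex.ofReal_mul] at h
  rw [← h, ← mul_assoc, mul_comm (b n), mul_assoc, ← MeasureTheory.integral_const_mul]
  congr 1
  refine integral_congr_ae (Eventually.of_forall fun y ↦ ?_)
  simp only
  rw [LSeries.term_of_ne_zero hn, Complex.mul_cpow_ofReal_nonneg hn0.le hw.le, div_eq_mul_inv,
    ← Complex.cpow_neg, Complex.ofReal_natCast]
  ring

/-- **Cahen–Mellin representation of `∑ bₙ e^{−nw}` at any abscissa.** If `∑ b(n) n^{−s}` is
absolutely summable at `re s = c > 0` and `w > 0`, then
`∑_{n ≥ 1} b(n) e^{−nw} = (1/2π) ∫ L(b, c+iy) · w^{−(c+iy)} Γ(c+iy) dy` (the tree's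
`tsum_mul_exp_neg_eq_integral_LSeries` without the restriction `c ≤ 2`). [folklore] -/
theorem tsum_mul_exp_neg_eq_integral_LSeries_of_pos (b : ℕ → ℂ) {c : ℝ} (hc : 0 < c)
    (hsum : LSeriesSummable b c) {w : ℝ} (hw : 0 < w) :
    ∑' n : ℕ, (if n = 0 then 0 else b n * (Real.exp (-(n * w)) : ℂ)) =
      (1 / (2 * π) : ℂ) * ∫ y : ℝ, LSeries b (c + y * I) *
        ((w : ℂ) ^ (-(c + y * I)) * Complex.Gamma (c + y * I)) := by
  have hΓ := integrable_Gamma_vertical_of_pos hc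
  set G : ℕ → ℝ → ℂ := fun n y ↦ LSeries.term b (c + y * I) n *
    ((w : ℂ) ^ (-(c + y * I)) * Complex.Gamma (c + y * I)) with hG
  have hnormG : ∀ n y, ‖G n y‖ =
      ‖LSeries.term b c n‖ * (w ^ (-c) * ‖Complex.Gamma (c + y * I)‖) := by
    intro n y
    simp only [hG, norm_mul]
    rw [Complex.norm_cpow_eq_rpow_re_of_pos hw]
    simp [LSeries.norm_term_eq]
  have hcontw : Continuous fun y : ℝ ↦ (w : ℂ) ^ (-(c + y * I)) :=
    Continuous.const_cpow (by fun_prop) (Or.inl (by exact_mod_cast hw.ne'))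
  have hcontn : ∀ n : ℕ, Continuous fun y : ℝ ↦ LSeries.term b (c + y * I) n := by
    intro n
    rcases eq_or_ne n 0 with rfl | hn
    · simp only [LSeries.term_zero]; exact continuous_const
    · simp only [LSeries.term_of_ne_zero hn, div_eq_mul_inv]
      refine continuous_const.mul (Continuous.inv₀ ?_ fun y ↦ ?_)
      · exact Continuous.const_cpow (by fun_prop) (Or.inl (by exact_mod_cast hn))
      · exact (Complex.cpow_ne_zero_iff_of_exponent_ne_zero (by
          intro h0; have := congrArg Complex.re h0; simp at this; linarith)).2
          (by exact_mod_cast hn)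
  have hint : ∀ n, Integrable (G n) := by
    intro n
    have h := hΓ.bdd_mul (((hcontn n).mul hcontw).aestronglyMeasurable)
      (c := ‖LSeries.term b c n‖ * w ^ (-c)) (Eventually.of_forall fun y ↦ ?_)
    · refine h.congr (Eventually.of_forall fun y ↦ ?_)
      simp only [hG, Pi.mul_apply]; ring
    · simp only [Pi.mul_apply]
      rw [norm_mul, Complex.norm_cpow_eq_rpow_re_of_pos hw]
      simp [LSeries.norm_term_eq]
  have hnormint : ∀ n, ∫ y, ‖G n y‖ = ‖LSeries.term b c n‖ * (w ^ (-c) *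
      ∫ y : ℝ, ‖Complex.Gamma (c + y * I)‖) := by
    intro n
    simp_rw [hnormG]
    rw [MeasureTheory.integral_const_mul, MeasureTheory.integral_const_mul]
  have hsumm : Summable fun n ↦ ∫ y, ‖G n y‖ := by
    simp_rw [hnormint]
    exact (summable_norm_iff.2 hsum).mul_right _
  calc ∑' n : ℕ, (if n = 0 then 0 else b n * (Real.exp (-(n * w)) : ℂ))
      = ∑' n : ℕ, (1 / (2 * π) : ℂ) * ∫ y : ℝ, G n y :=
        tsum_congr fun n ↦ mul_exp_neg_eq_integral_term_of_pos b hc hw n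
    _ = (1 / (2 * π) : ℂ) * ∑' n : ℕ, ∫ y : ℝ, G n y := tsum_mul_left
    _ = (1 / (2 * π) : ℂ) * ∫ y : ℝ, ∑' n : ℕ, G n y := by
        rw [integral_tsum_of_summable_integral_norm hint hsumm]
    _ = _ := by
        congr 1
        refine integral_congr_ae (Eventually.of_forall fun y ↦ ?_)
        simp only [hG]
        rw [tsum_mul_right, LSeries]

end Hamburger1921

end Literature.Barriers.RiemannHypothesis
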